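import Summits.Ventures.Crystal3D.Theorems.StickyWulffConstantTextureLiminfTexShadowLevelReachCutSetMover
import Summits.Ventures.Crystal3D.Theorems.StickyWulffConstantCoaxialWallLawPayerEndPairsMultiPlates
import HarnessLib

/-!
# Lane F's PLATES census cut at a set of letters, single and multi-root, WITH BOTH END-PAIR LINKS (end ball's and mover's invariant)
# (lane T, crux `TextureLiminfV5`, stmt-Ventures-23912, registered stub `stub_terraceCensus`; (β) assembly — root-class-only bi-family row, cf-p1 (ccxcviii) (a2))

HONEST FRAMING. Venture `Summits/Ventures/Crystal3D` (cell `crystal3d-full`), route `route-Ventures-StickyWulffConstant`, helper `--supports` the law-v5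
crux `TextureLiminfV5` (stmt-Ventures-23912), lane T, mechanism (β).  Census-free, certificate-free; `KissingGap δ`, `KissingClassification δ` BY NAME; F-C1 not moved.

THE POINT.  `word_family_endPairs_plates_cuts_shape` / `word_endPairs_multi_plates_cuts_shape` (…LevelReachPlatesCutShape) VERBATIM over
`word_family_endPairs_launch_cuts_mover` (…LevelReachCutSetMover): the sources carry the invariant at the source itself (`hPsrc` gains `P (p, [])`), and the
witness clause carries the MOVER's invariant `P (bq.2, κ)` — so for an all-cut census every exported pair is a straight root-class move read in the root class.
* `word_family_endPairs_plates_cuts_mover`, **`word_endPairs_multi_plates_cuts_mover`**.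
WHAT THIS IS NOT: the Barlow instantiation, the row; F-C1 not moved.
-/

noncomputable section

namespace Summit.Ventures.Crystal3D.Theorems

open Summit.Ventures.Crystal3D Finset
open scoped InnerProductSpace

section Plates

variable {X : Finset (EuclideanSpace ℝ (Fin 3))}
  {F : List (EuclideanSpace ℝ (Fin 3)) → (EuclideanSpace ℝ (Fin 3) ≃ₗᵢ[ℝ] EuclideanSpace ℝ (Fin 3))}
  {u : List (EuclideanSpace ℝ (Fin 3)) → EuclideanSpace ℝ (Fin 3)}
  {WF : List (EuclideanSpace ℝ (Fin 3)) → Prop}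
  {next : List (EuclideanSpace ℝ (Fin 3)) → EuclideanSpace ℝ (Fin 3) → List (EuclideanSpace ℝ (Fin 3))}
  {P' P₂ : Finset (EuclideanSpace ℝ (Fin 3))} {R₀ h ρ : ℝ}

open scoped Classical in
/-- **Lane F's plates census, CUT at the set `C` of letters.**  Hypotheses VERBATIM from `word_family_endPairs_plates` except the cut predicate `C`
(`hC`) and `hPcross` required only off the cut (`κ ≠ [] ∨ ¬ C ((F []).symm m)`).  Conclusion: its conclusion plus the located cut term, no relaunch term; the invariant clause in the LINKED (shape) form. -/
theorem word_family_endPairs_plates_cuts_mover (ver : WordVersion) {δ : ℝ} (hg : KissingGap δ) (hc : KissingClassification δ)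
    (hX : ∀ p ∈ X, ∀ q ∈ X, p ≠ q → 1 ≤ dist p q)
    (hFc : ∀ μ κ, F (μ :: κ) = ((ℝ ∙ μ)ᗮ.reflection).trans (F κ))
    (hu : ∀ κ, u κ ∈ fccSlots) (huc : ∀ μ κ, u (μ :: κ) = -u κ)
    (hWF0 : WF [])
    (hWFc : ∀ μ κ, WF (μ :: κ) ↔ (WF κ ∧ ‖μ‖ = 1 ∧
      (∀ w ∈ fccSlots, ⟪w, μ⟫_ℝ = 0 ∨ ⟪w, μ⟫_ℝ = Real.sqrt (2 / 3) ∨ ⟪w, μ⟫_ℝ = -Real.sqrt (2 / 3)) ∧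
      ⟪u κ, μ⟫_ℝ = Real.sqrt (2 / 3) ∧ ∀ μ' κ', κ = μ' :: κ' → μ' ≠ -μ))
    (hnext_pop : ∀ μ κ' (m : EuclideanSpace ℝ (Fin 3)), (F (μ :: κ')).symm m = -μ → next (μ :: κ') m = κ')
    (hnext_push : ∀ κ (m : EuclideanSpace ℝ (Fin 3)), (∀ μ κ', κ = μ :: κ' → (F κ).symm m ≠ -μ) →
      next κ m = (F κ).symm m :: κ)
    -- the CUT letters: each crossed upward by the root direction
    (C : EuclideanSpace ℝ (Fin 3) → Prop) (hC : ∀ μ, C μ → ⟪u [], μ⟫_ℝ = Real.sqrt (2 / 3))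
    -- the state invariant (preserved by LEGAL moves off the cut) and the top exclusion
    {P : EuclideanSpace ℝ (Fin 3) × List (EuclideanSpace ℝ (Fin 3)) → Prop}
    (hPstraight : ∀ (b : EuclideanSpace ℝ (Fin 3)) (κ : List (EuclideanSpace ℝ (Fin 3))), WF κ →
      (IsFull X (F κ) b ∨ (∃ m, IsTwinReading X (F κ) m b ∧ ⟪F κ (u κ), m⟫_ℝ = 0) ∨
        (ver = WordVersion.v2 ∧ IsNarrow X (F κ) (F κ (u κ)) b)) →
      P (b, κ) → P (b + F κ (u κ), κ))
    (hPcross : ∀ (b : EuclideanSpace ℝ (Fin 3)) (κ : List (EuclideanSpace ℝ (Fin 3))) (m : EuclideanSpace ℝ (Fin 3)),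
      WF κ → WF (next κ m) → IsTwinReading X (F κ) m b → ⟪F κ (u κ), m⟫_ℝ = Real.sqrt (2 / 3) →
      (κ ≠ [] ∨ ¬ C ((F []).symm m)) →
      P (b, κ) → P (b + F (next κ m) (u (next κ m)), next κ m))
    (hPexcl0 : ∀ (b : EuclideanSpace ℝ (Fin 3)) (κ : List (EuclideanSpace ℝ (Fin 3))), WF κ → P (b, κ) → b ∈ P₂ →
      (∃ a ∈ fccSlots, ∃ a' ∈ fccSlots, ∃ a'' ∈ fccSlots,
        ⟪a, a'⟫_ℝ = 1 / 2 ∧ ⟪a, a''⟫_ℝ = 1 / 2 ∧ ⟪a', a''⟫_ℝ = 1 / 2 ∧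
        b + F κ a ∈ X ∧ b + F κ a' ∈ X ∧ b + F κ a'' ∈ X) → False)
    (hup : 0 < (F [] (u [])) 2) (hR₀ : 3 ≤ R₀) (hρ : R₀ ≤ ρ)
    -- the bottom plate's CORE and its SOURCES (verbatim `word_family_endPairs_plates`)
    (srcOK : EuclideanSpace ℝ (Fin 3) → Prop)
    (hP'top : ∀ p ∈ P', p 2 ≤ -R₀ - 1)
    (hPsrc : ∀ p ∈ P', srcOK p → p ∈ X ∧
      (∃ a ∈ fccSlots, ∃ a' ∈ fccSlots, ∃ a'' ∈ fccSlots,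
        ⟪a, a'⟫_ℝ = 1 / 2 ∧ ⟪a, a''⟫_ℝ = 1 / 2 ∧ ⟪a', a''⟫_ℝ = 1 / 2 ∧
        p + F [] a ∈ X ∧ p + F [] a' ∈ X ∧ p + F [] a'' ∈ X) ∧
      p - F [] (u []) ∈ X ∧
      (IsFull X (F []) p ∨ (∃ m, IsTwinReading X (F []) m p ∧ ⟪F [] (u []), m⟫_ℝ = 0) ∨
        (ver = WordVersion.v2 ∧ IsNarrow X (F []) (F [] (u [])) p)) ∧
      P (p, []) ∧ P (p + F [] (u []), []))
    (hstd : ∀ κ, WF κ → ∀ p ∈ P', (∃ a ∈ fccSlots, ∃ a' ∈ fccSlots, ∃ a'' ∈ fccSlots,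
        ⟪a, a'⟫_ℝ = 1 / 2 ∧ ⟪a, a''⟫_ℝ = 1 / 2 ∧ ⟪a', a''⟫_ℝ = 1 / 2 ∧
        p + F κ a ∈ X ∧ p + F κ a' ∈ X ∧ p + F κ a'' ∈ X) → F κ (u κ) = F [] (u []))
    (hsealB : ∀ s ∈ X, s ∉ P' → -R₀ - 1 - 1 ≤ s 2 → s 2 < -R₀ - 1 → s 0 ^ 2 + s 1 ^ 2 ≤ (ρ - 1) ^ 2 → False)
    (hP₂seal : ∀ s ∈ X, h + R₀ + 1 ≤ s 2 → s 2 ≤ h + R₀ + 1 + 1 → s 0 ^ 2 + s 1 ^ 2 ≤ (ρ - 2) ^ 2 → s ∈ P₂) :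
    ∃ T : Finset (EuclideanSpace ℝ (Fin 3) × EuclideanSpace ℝ (Fin 3)),
      (P'.filter fun p => srcOK p ∧
          -R₀ - 1 < (p + F [] (u [])) 2 ∧ (p + F [] (u [])) 2 < h + R₀ + 1).card ≤
        T.card +
        (X.filter fun b => -R₀ - 1 ≤ b 2 ∧ b 2 < h + R₀ + 1 ∧ (∃ μ, C μ ∧ IsTwinReading X (F []) (F [] μ) b) ∧ P (b, []) ∧
            b - F [] (u []) ∈ X).card +
        220 * (X.filter fun s => h + R₀ + 1 ≤ s 2 ∧ s 2 ≤ h + R₀ + 1 + 1 ∧ (ρ - 2) ^ 2 < s 0 ^ 2 + s 1 ^ 2).card +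
        220 * (X.filter fun s => -R₀ - 1 - 1 ≤ s 2 ∧ s 2 < -R₀ - 1 ∧ (ρ - 1) ^ 2 < s 0 ^ 2 + s 1 ^ 2).card ∧
      (∀ bq ∈ T, bq.1 ∈ X ∧ bq.2 ∈ X ∧ dist bq.1 bq.2 = 1 ∧ -R₀ - 1 ≤ bq.1 2 ∧ bq.1 2 < h + R₀ + 1) ∧
      (∀ bq ∈ T, (X.filter fun q => dist bq.1 q = 1).card ≤ 11 ∨
        ∃ z₁ ∈ X, ∃ z₂ ∈ X, z₁ ≠ z₂ ∧ dist bq.1 z₁ = 1 ∧ dist bq.1 z₂ = 1 ∧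
          (X.filter fun q => dist z₁ q = 1).card ≤ 11 ∧ (X.filter fun q => dist z₂ q = 1).card ≤ 11) ∧
      (∀ bq ∈ T, ∃ κ, WF κ ∧ P (bq.1, κ) ∧ bq.2 = bq.1 - F κ (u κ) ∧ ¬ IsMoving X ver (F κ) (F κ (u κ)) bq.1) ∧
      (∀ bq ∈ T, ∃ κ, WF κ ∧ P (bq.2, κ) ∧ bq.2 - F κ (u κ) ∈ X ∧ IsEndMove X ver (F κ) (F κ (u κ)) bq.2 bq.1) := by
  classical
  set L : Finset (EuclideanSpace ℝ (Fin 3)) := P'.filter fun p => srcOK p ∧ -R₀ - 1 < (p + F [] (u [])) 2 with hL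
  have hLsrc : ∀ p ∈ L, p ∈ X ∧
      (∃ a ∈ fccSlots, ∃ a' ∈ fccSlots, ∃ a'' ∈ fccSlots,
        ⟪a, a'⟫_ℝ = 1 / 2 ∧ ⟪a, a''⟫_ℝ = 1 / 2 ∧ ⟪a', a''⟫_ℝ = 1 / 2 ∧
        p + F [] a ∈ X ∧ p + F [] a' ∈ X ∧ p + F [] a'' ∈ X) ∧
      p - F [] (u []) ∈ X ∧
      (IsFull X (F []) p ∨ (∃ m, IsTwinReading X (F []) m p ∧ ⟪F [] (u []), m⟫_ℝ = 0) ∨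
        (ver = WordVersion.v2 ∧ IsNarrow X (F []) (F [] (u [])) p)) ∧
      P (p, []) ∧ P (p + F [] (u []), []) := fun p hp => hPsrc p (mem_filter.1 hp).1 (mem_filter.1 hp).2.1
  -- a source steps out of the core: no self-succession
  have hLstep : ∀ p ∈ L, p + F [] (u []) ∉ L := by
    intro p hp hmem
    have h1 := (mem_filter.1 hp).2.2
    have h2 := hP'top _ (mem_filter.1 hmem).1
    linarith
  obtain ⟨T, hbound, h1, h2, h3, h4⟩ := word_family_endPairs_launch_cuts_mover ver hg hc hX hFc hu huc hWF0 hWFc hnext_pop hnext_push C hC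
    hPstraight hPcross hPexcl0 hup hR₀ hρ L hLsrc hLstep hP'top hstd hsealB hP₂seal
  refine ⟨T, ?_, h1, h2, h3, h4⟩
  -- the sources of the plates census are the launches stepping into the window
  have hLHS : (P'.filter fun p => srcOK p ∧ -R₀ - 1 < (p + F [] (u [])) 2 ∧ (p + F [] (u [])) 2 < h + R₀ + 1).card =
      (L.filter fun p => -R₀ - 1 < (p + F [] (u [])) 2 ∧ (p + F [] (u [])) 2 < h + R₀ + 1).card := by
    congr 1; ext p; simp only [hL, mem_filter]; tauto
  rw [hLHS]
  refine hbound.trans ?_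
  -- NO relaunch: an arriving window state would sit at `p − F [] (u [])`, strictly below the window for a core ball `p`
  rw [Finset.card_eq_zero.2 ((Finset.filter_eq_empty_iff (s := L)).2 ?_), add_zero]
  intro p hp hpred
  have hpz : p 2 ≤ -R₀ - 1 := hP'top _ (mem_filter.1 hp).1
  have e : (p - F [] (u [])) 2 = p 2 - (F [] (u [])) 2 := rfl
  rcases hpred with ⟨-, hlo, -, -⟩ | ⟨μ, -, -, -, hlo, -, -⟩
  · rw [e] at hlo; linarith
  · rw [e] at hlo; linarith

end Plates

section MultiRootPlatesCut

variable {X : Finset (EuclideanSpace ℝ (Fin 3))}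
  {F : List (EuclideanSpace ℝ (Fin 3)) → (EuclideanSpace ℝ (Fin 3) ≃ₗᵢ[ℝ] EuclideanSpace ℝ (Fin 3))}
  {u : EuclideanSpace ℝ (Fin 3) → List (EuclideanSpace ℝ (Fin 3)) → EuclideanSpace ℝ (Fin 3)}
  {WF : EuclideanSpace ℝ (Fin 3) → List (EuclideanSpace ℝ (Fin 3)) → Prop}
  {next : List (EuclideanSpace ℝ (Fin 3)) → EuclideanSpace ℝ (Fin 3) → List (EuclideanSpace ℝ (Fin 3))}
  {P' P₂ : Finset (EuclideanSpace ℝ (Fin 3))} {R₀ h ρ : ℝ}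

open scoped Classical in
/-- **The multi-root plates census with per-root cut sets.**  Hypotheses VERBATIM from `word_endPairs_multi_plates` except the root-indexed cut predicate `C`
(`hC`) and `hPcross r` required only off the cut of `r`; conclusion = its conclusion plus `Σ_r #CUT_r`, the invariant clause in the LINKED (shape) form.  See the module docstring. -/
theorem word_endPairs_multi_plates_cuts_mover (ver : WordVersion) {δ : ℝ} (hg : KissingGap δ) (hc : KissingClassification δ)
    (hX : ∀ p ∈ X, ∀ q ∈ X, p ≠ q → 1 ≤ dist p q)
    (hFc : ∀ μ κ, F (μ :: κ) = ((ℝ ∙ μ)ᗮ.reflection).trans (F κ))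
    (RT : Finset (EuclideanSpace ℝ (Fin 3))) (hRT : ∀ r ∈ RT, r ∈ fccSlots)
    (hu0 : ∀ r ∈ RT, u r [] = r) (huc : ∀ r ∈ RT, ∀ μ κ, u r (μ :: κ) = -u r κ)
    (hWF0 : ∀ r ∈ RT, WF r [])
    (hWFc : ∀ r ∈ RT, ∀ μ κ, WF r (μ :: κ) ↔ (WF r κ ∧ ‖μ‖ = 1 ∧
      (∀ w ∈ fccSlots, ⟪w, μ⟫_ℝ = 0 ∨ ⟪w, μ⟫_ℝ = Real.sqrt (2 / 3) ∨ ⟪w, μ⟫_ℝ = -Real.sqrt (2 / 3)) ∧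
      ⟪u r κ, μ⟫_ℝ = Real.sqrt (2 / 3) ∧ ∀ μ' κ', κ = μ' :: κ' → μ' ≠ -μ))
    (hnext_pop : ∀ μ κ' (m : EuclideanSpace ℝ (Fin 3)), (F (μ :: κ')).symm m = -μ → next (μ :: κ') m = κ')
    (hnext_push : ∀ κ (m : EuclideanSpace ℝ (Fin 3)), (∀ μ κ', κ = μ :: κ' → (F κ).symm m ≠ -μ) →
      next κ m = (F κ).symm m :: κ)
    -- the root-indexed CUT letters, each crossed upward by its root
    (C : EuclideanSpace ℝ (Fin 3) → EuclideanSpace ℝ (Fin 3) → Prop) (hC : ∀ r ∈ RT, ∀ μ, C r μ → ⟪u r [], μ⟫_ℝ = Real.sqrt (2 / 3))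
    -- the root-indexed state invariants (preserved by LEGAL moves off the cut)
    {P : EuclideanSpace ℝ (Fin 3) → EuclideanSpace ℝ (Fin 3) × List (EuclideanSpace ℝ (Fin 3)) → Prop}
    (hPstraight : ∀ r ∈ RT, ∀ (b : EuclideanSpace ℝ (Fin 3)) (κ : List (EuclideanSpace ℝ (Fin 3))), WF r κ →
      (IsFull X (F κ) b ∨ (∃ m, IsTwinReading X (F κ) m b ∧ ⟪F κ (u r κ), m⟫_ℝ = 0) ∨
        (ver = WordVersion.v2 ∧ IsNarrow X (F κ) (F κ (u r κ)) b)) →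
      P r (b, κ) → P r (b + F κ (u r κ), κ))
    (hPcross : ∀ r ∈ RT, ∀ (b : EuclideanSpace ℝ (Fin 3)) (κ : List (EuclideanSpace ℝ (Fin 3)))
      (m : EuclideanSpace ℝ (Fin 3)), WF r κ → WF r (next κ m) → IsTwinReading X (F κ) m b →
      ⟪F κ (u r κ), m⟫_ℝ = Real.sqrt (2 / 3) → (κ ≠ [] ∨ ¬ C r ((F []).symm m)) → P r (b, κ) →
      P r (b + F (next κ m) (u r (next κ m)), next κ m))
    (hPexcl0 : ∀ r ∈ RT, ∀ (b : EuclideanSpace ℝ (Fin 3)) (κ : List (EuclideanSpace ℝ (Fin 3))), WF r κ → P r (b, κ) →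
      b ∈ P₂ →
      (∃ a ∈ fccSlots, ∃ a' ∈ fccSlots, ∃ a'' ∈ fccSlots,
        ⟪a, a'⟫_ℝ = 1 / 2 ∧ ⟪a, a''⟫_ℝ = 1 / 2 ∧ ⟪a', a''⟫_ℝ = 1 / 2 ∧
        b + F κ a ∈ X ∧ b + F κ a' ∈ X ∧ b + F κ a'' ∈ X) → False)
    (hup : ∀ r ∈ RT, 0 < (F [] r) 2)
    -- the cell
    (hR₀ : 3 ≤ R₀) (hρ : R₀ ≤ ρ)
    -- the bottom plate's CORE and its root-indexed SOURCES
    (srcOK : EuclideanSpace ℝ (Fin 3) → EuclideanSpace ℝ (Fin 3) → Prop)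
    (hP'top : ∀ p ∈ P', p 2 ≤ -R₀ - 1)
    (hPsrc : ∀ r ∈ RT, ∀ p ∈ P', srcOK r p → p ∈ X ∧
      (∃ a ∈ fccSlots, ∃ a' ∈ fccSlots, ∃ a'' ∈ fccSlots,
        ⟪a, a'⟫_ℝ = 1 / 2 ∧ ⟪a, a''⟫_ℝ = 1 / 2 ∧ ⟪a', a''⟫_ℝ = 1 / 2 ∧
        p + F [] a ∈ X ∧ p + F [] a' ∈ X ∧ p + F [] a'' ∈ X) ∧
      p - F [] r ∈ X ∧
      (IsFull X (F []) p ∨ (∃ m, IsTwinReading X (F []) m p ∧ ⟪F [] r, m⟫_ℝ = 0) ∨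
        (ver = WordVersion.v2 ∧ IsNarrow X (F []) (F [] r) p)) ∧
      P r (p, []) ∧ P r (p + F [] r, []))
    -- rigidity at the core: an `r`-class reading an occupied face at a core ball moves in the root direction
    (hstd : ∀ r ∈ RT, ∀ κ, WF r κ → ∀ p ∈ P', (∃ a ∈ fccSlots, ∃ a' ∈ fccSlots, ∃ a'' ∈ fccSlots,
        ⟪a, a'⟫_ℝ = 1 / 2 ∧ ⟪a, a''⟫_ℝ = 1 / 2 ∧ ⟪a', a''⟫_ℝ = 1 / 2 ∧
        p + F κ a ∈ X ∧ p + F κ a' ∈ X ∧ p + F κ a'' ∈ X) → F κ (u r κ) = F [] r)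
    -- sealing: below the window off the core, and above the window into the top plate
    (hsealB : ∀ s ∈ X, s ∉ P' → -R₀ - 1 - 1 ≤ s 2 → s 2 < -R₀ - 1 → s 0 ^ 2 + s 1 ^ 2 ≤ (ρ - 1) ^ 2 → False)
    (hP₂seal : ∀ s ∈ X, h + R₀ + 1 ≤ s 2 → s 2 ≤ h + R₀ + 1 + 1 → s 0 ^ 2 + s 1 ^ 2 ≤ (ρ - 2) ^ 2 → s ∈ P₂) :
    ∃ T : Finset (EuclideanSpace ℝ (Fin 3) × EuclideanSpace ℝ (Fin 3)),
      ∑ r ∈ RT, (P'.filter fun p => srcOK r p ∧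
          -R₀ - 1 < (p + F [] r) 2 ∧ (p + F [] r) 2 < h + R₀ + 1).card ≤
        T.card +
        ∑ r ∈ RT, (X.filter fun b => -R₀ - 1 ≤ b 2 ∧ b 2 < h + R₀ + 1 ∧ (∃ μ, C r μ ∧ IsTwinReading X (F []) (F [] μ) b) ∧
            P r (b, []) ∧ b - F [] r ∈ X).card + RT.card *
          (220 * (X.filter fun s => h + R₀ + 1 ≤ s 2 ∧ s 2 ≤ h + R₀ + 1 + 1 ∧ (ρ - 2) ^ 2 < s 0 ^ 2 + s 1 ^ 2).card +
           220 * (X.filter fun s => -R₀ - 1 - 1 ≤ s 2 ∧ s 2 < -R₀ - 1 ∧ (ρ - 1) ^ 2 < s 0 ^ 2 + s 1 ^ 2).card) ∧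
      (∀ bq ∈ T, bq.1 ∈ X ∧ bq.2 ∈ X ∧ dist bq.1 bq.2 = 1 ∧ -R₀ - 1 ≤ bq.1 2 ∧ bq.1 2 < h + R₀ + 1) ∧
      (∀ bq ∈ T, (X.filter fun q => dist bq.1 q = 1).card ≤ 11 ∨
        ∃ z₁ ∈ X, ∃ z₂ ∈ X, z₁ ≠ z₂ ∧ dist bq.1 z₁ = 1 ∧ dist bq.1 z₂ = 1 ∧
          (X.filter fun q => dist z₁ q = 1).card ≤ 11 ∧ (X.filter fun q => dist z₂ q = 1).card ≤ 11) ∧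
      (∀ bq ∈ T, ∃ r ∈ RT, (∃ κ, WF r κ ∧ P r (bq.1, κ) ∧ bq.2 = bq.1 - F κ (u r κ) ∧ ¬ IsMoving X ver (F κ) (F κ (u r κ)) bq.1) ∧
        ∃ κ, WF r κ ∧ P r (bq.2, κ) ∧ bq.2 - F κ (u r κ) ∈ X ∧ IsEndMove X ver (F κ) (F κ (u r κ)) bq.2 bq.1) := by
  set RIM : ℕ :=
    220 * (X.filter fun s => h + R₀ + 1 ≤ s 2 ∧ s 2 ≤ h + R₀ + 1 + 1 ∧ (ρ - 2) ^ 2 < s 0 ^ 2 + s 1 ^ 2).card +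
      220 * (X.filter fun s => -R₀ - 1 - 1 ≤ s 2 ∧ s 2 < -R₀ - 1 ∧ (ρ - 1) ^ 2 < s 0 ^ 2 + s 1 ^ 2).card with hRIM
  set CUT : EuclideanSpace ℝ (Fin 3) → ℕ := fun r => (X.filter fun b => -R₀ - 1 ≤ b 2 ∧ b 2 < h + R₀ + 1 ∧
    (∃ μ, C r μ ∧ IsTwinReading X (F []) (F [] μ) b) ∧ P r (b, []) ∧ b - F [] r ∈ X).card with hCUT
  -- the per-family end pairs, each family with its own invariant `P r` and its own sources `srcOK r`
  have hfam : ∀ r ∈ RT, ∃ T : Finset (EuclideanSpace ℝ (Fin 3) × EuclideanSpace ℝ (Fin 3)),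
      (P'.filter fun p => srcOK r p ∧
          -R₀ - 1 < (p + F [] r) 2 ∧ (p + F [] r) 2 < h + R₀ + 1).card ≤ T.card + CUT r + RIM ∧
      (∀ bq ∈ T, bq.1 ∈ X ∧ bq.2 ∈ X ∧ dist bq.1 bq.2 = 1 ∧ -R₀ - 1 ≤ bq.1 2 ∧ bq.1 2 < h + R₀ + 1) ∧
      (∀ bq ∈ T, (X.filter fun q => dist bq.1 q = 1).card ≤ 11 ∨
        ∃ z₁ ∈ X, ∃ z₂ ∈ X, z₁ ≠ z₂ ∧ dist bq.1 z₁ = 1 ∧ dist bq.1 z₂ = 1 ∧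
          (X.filter fun q => dist z₁ q = 1).card ≤ 11 ∧ (X.filter fun q => dist z₂ q = 1).card ≤ 11) ∧
      (∀ bq ∈ T, ∃ κ, WF r κ ∧ P r (bq.1, κ) ∧ bq.2 = bq.1 - F κ (u r κ) ∧ ¬ IsMoving X ver (F κ) (F κ (u r κ)) bq.1) ∧
      (∀ bq ∈ T, ∃ κ, WF r κ ∧ P r (bq.2, κ) ∧ bq.2 - F κ (u r κ) ∈ X ∧ IsEndMove X ver (F κ) (F κ (u r κ)) bq.2 bq.1) := by
    intro r hr
    have hur : ∀ κ, u r κ ∈ fccSlots := word_u_mem (hRT r hr) (hu0 r hr) (huc r hr)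
    have hup' : 0 < (F [] (u r [])) 2 := by rw [hu0 r hr]; exact hup r hr
    have hPsrc' : ∀ p ∈ P', srcOK r p → p ∈ X ∧
        (∃ a ∈ fccSlots, ∃ a' ∈ fccSlots, ∃ a'' ∈ fccSlots,
          ⟪a, a'⟫_ℝ = 1 / 2 ∧ ⟪a, a''⟫_ℝ = 1 / 2 ∧ ⟪a', a''⟫_ℝ = 1 / 2 ∧
          p + F [] a ∈ X ∧ p + F [] a' ∈ X ∧ p + F [] a'' ∈ X) ∧
        p - F [] (u r []) ∈ X ∧
        (IsFull X (F []) p ∨ (∃ m, IsTwinReading X (F []) m p ∧ ⟪F [] (u r []), m⟫_ℝ = 0) ∨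
          (ver = WordVersion.v2 ∧ IsNarrow X (F []) (F [] (u r [])) p)) ∧
        P r (p, []) ∧ P r (p + F [] (u r []), []) := by rw [hu0 r hr]; exact hPsrc r hr
    have hstd' : ∀ κ, WF r κ → ∀ p ∈ P', (∃ a ∈ fccSlots, ∃ a' ∈ fccSlots, ∃ a'' ∈ fccSlots,
        ⟪a, a'⟫_ℝ = 1 / 2 ∧ ⟪a, a''⟫_ℝ = 1 / 2 ∧ ⟪a', a''⟫_ℝ = 1 / 2 ∧
        p + F κ a ∈ X ∧ p + F κ a' ∈ X ∧ p + F κ a'' ∈ X) → F κ (u r κ) = F [] (u r []) := by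
      rw [hu0 r hr]; exact hstd r hr
    have hC' : ∀ μ, C r μ → ⟪u r [], μ⟫_ℝ = Real.sqrt (2 / 3) := hC r hr
    obtain ⟨T, hkey, hT, hpay, hinv, hwit⟩ := word_family_endPairs_plates_cuts_mover ver (F := F) (u := u r) (WF := WF r)
      (next := next) (P := P r) hg hc hX hFc hur (huc r hr) (hWF0 r hr) (hWFc r hr)
      hnext_pop hnext_push (C r) hC' (hPstraight r hr) (hPcross r hr) (hPexcl0 r hr) hup' hR₀ hρ (srcOK r) hP'top hPsrc' hstd'
      hsealB hP₂seal
    rw [hu0 r hr] at hkey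
    exact ⟨T, by rw [hCUT, hRIM]; linarith [hkey], hT, hpay, hinv, hwit⟩
  choose! Tf hTkey hTpair hTpay hTinv hTwit using hfam
  -- pairwise disjointness across roots: LEMMA X (shape form)
  have hdisj : ∀ r ∈ RT, ∀ r' ∈ RT, r ≠ r' → Disjoint (Tf r) (Tf r') := by
    intro r hr r' hr' hrr'
    rw [Finset.disjoint_left]
    intro bq hbq hbq'
    obtain ⟨κ, hκ, -, -, hmove⟩ := hTwit r hr bq hbq
    obtain ⟨κ', hκ', -, -, hmove'⟩ := hTwit r' hr' bq hbq'
    obtain ⟨hlet, hch⟩ := word_letters_of_wf (huc r hr) (hWFc r hr) κ hκ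
    obtain ⟨hlet', hch'⟩ := word_letters_of_wf (huc r' hr') (hWFc r' hr') κ' hκ'
    have hob := word_letters_oblique_of_wf (huc r hr) (hWFc r hr) κ hκ
    have hob' := word_letters_oblique_of_wf (huc r' hr') (hWFc r' hr') κ' hκ'
    rw [hu0 r hr] at hob
    rw [hu0 r' hr'] at hob'
    have hne' : r ≠ -r' := by
      intro h
      have h1 := hup r hr
      have h2 := hup r' hr'
      rw [h, map_neg, PiLp.neg_apply] at h1
      linarith
    have hd : F κ (u r κ) = F κ (((-1 : ℝ) ^ κ.length) • r) := by rw [word_u_eq_pow (huc r hr) κ, hu0 r hr]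
    have hd' : F κ' (u r' κ') = F κ' (((-1 : ℝ) ^ κ'.length) • r') := by
      rw [word_u_eq_pow (huc r' hr') κ', hu0 r' hr']
    exact word_target_ne_of_roots_ne_shape hFc hlet hlet' hch hch' (hRT r hr) (hRT r' hr') hrr' hne' hob hob'
      (neg_one_pow_eq_or ℝ κ.length) (neg_one_pow_eq_or ℝ κ'.length) hd hd'
      (shape_of_isEndMove hmove) (shape_of_isEndMove hmove') rfl
  -- export the pooled pair set
  refine ⟨RT.biUnion Tf, ?_, ?_, ?_, ?_⟩
  · rw [card_biUnion hdisj]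
    calc ∑ r ∈ RT, (P'.filter fun p => srcOK r p ∧
            -R₀ - 1 < (p + F [] r) 2 ∧ (p + F [] r) 2 < h + R₀ + 1).card
        ≤ ∑ r ∈ RT, ((Tf r).card + CUT r + RIM) := sum_le_sum fun r hr => hTkey r hr
      _ = ∑ r ∈ RT, (Tf r).card + ∑ r ∈ RT, CUT r + RT.card * RIM := by
          rw [sum_add_distrib, sum_add_distrib, sum_const, smul_eq_mul]
      _ ≤ _ := by rw [hCUT, hRIM]
  · intro bq hbq
    obtain ⟨r, hr, hbqr⟩ := mem_biUnion.1 hbq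
    exact hTpair r hr bq hbqr
  · intro bq hbq
    obtain ⟨r, hr, hbqr⟩ := mem_biUnion.1 hbq
    exact hTpay r hr bq hbqr
  · intro bq hbq
    obtain ⟨r, hr, hbqr⟩ := mem_biUnion.1 hbq
    exact ⟨r, hr, hTinv r hr bq hbqr, hTwit r hr bq hbqr⟩

end MultiRootPlatesCut

end Summit.Ventures.Crystal3D.Theorems

end
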